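import Summits.Schanuel.Schanuel.Theorems.RootDecomp1KSubspaceBranch02

/-!
# RootDecomp1KSubspaceBranch — lens 1, generation 52, node 11 «p-ADIC SUBSPACE AT THE LIVE NEAR-ROOT BRANCH — m₀ = 2 BELOW RIDOUT'S EXPONENT» (RULE K-R40 (viii)(α)) — continuation (RootDecomp1KSubspaceBranch03): §6 subspace-by-subspace finiteness of levels, §7 assembly thinFibreAt_xPoly_of_padicSubspace

(lens-1 g52 node 11 HOME kernel K = HOME/decomp-schanuel-lens-1/g52/SubspaceBranch.lean a7b59aa9…, 1162 l, 79 thm + 9 def, imports tree …RootDecomp1KXTop03 + …RootDecomp1KXAll05 + …RootDecomp1KLevelFinite11 + …RootDecomp1KLevelFinite13 ONLY; Probe SubspaceBranchProbe.lean 53090850… / Ctrl0 d8674a5f… / Ctrl 041869f9…; memo NODE-g52.md 489a38e4…; SHA256SUMS; cite-kind ledger item wi-102433 (PadicSubspace → statement-only Literature fact typed to Bilu, Sém. Bourbaki 967 Thm 2.3); CLAIM L2534, crit EX-ANTE PRICE L2535 (ONE THEOREM ×1 «SUBSPACE BRANCH» under RULE K-R40 (viii)(α) iff CHECKLIST K-g52;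 RULE K-R41), NODE L2542 / REQUEST L2543, writer re-check L2548, critic VERDICT L2546: CLEARED — THEOREM ×1 «SUBSPACE BRANCH» under RULE K-R40 (viii)(α), CHECKLIST K-g52 met; PORT GO L2546/L2547 (A) (four parts, docstrings, private re-emissions, scoped maxHeartbeats, «(sources: …)» binder — sanctioned ex ante); RULES K-R41 / K-R42. Port by census-1 gen 22 as `RootDecomp1KSubspaceBranch01–04` (`--supports stmt-Schanuel-33364`; no census credit): 01 = §0 the ONE new Diophantine input typed by name **`PadicSubspace : Prop`** ([hypothesis] definition — Schlickewei's p-adic Subspace Theorem over `ℚ` at `{∞, p}`, integer points, algebraic coefficients, `ε = 1/q`; sources in the docstring; a THEOREM in print, NOT proved in the tree; NOT the tree's rational-form `Subspace*` I–VI) + §1 helpers + §2 the ultrametric Taylor tail + §3 the second-order level identity and the refined approximation `‖r − β + 2^{N!}·γ_β‖₂` at a simple root; 02 = §4 algebraicity of the correction `γ_β`, the integer vector `xvec N r = (num r, den r, 2^{N!}·den r)` and the `3 + 3` linear forms `Lform` / `Mform` (linear independence, algebraicity) + §5 the exponent inequality (`ε = 1/8`, `N₀ = N₀(C, P)`); 03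 = §6 subspace-by-subspace finiteness of levels (no Diophantine input) + §7 ASSEMBLY **`thinFibreAt_xPoly_of_padicSubspace (hS : PadicSubspace) … (hsep) (hdeg) (hm : 2 ≤ m₀) (hme : e + 1 ≤ m₀) : ThinFibreAt m₀ (xPolyP k c)`** (the tree's `RootDecomp1KXTop.thinFibreAt_xPoly` with `3 ≤ m₀` replaced by `2 ≤ m₀`; the `m₀ ≥ 3` branch delegated to the tree by name); 04 = §8 intrinsic form + the residual of record RE-BOOKED (`SiegelShapesOffSbAt`, `ThinFibre m₀ ⟸ PadicSubspace ∧ SiegelShapesOffSbAt m₀`; bookkeeping ×0 by K-R40 (vi)) + §9 members at `m₀ = 2` (`M17P` = x²(Y²−17) + x(Y³+Y+1) + (Y³−2), `L17P` = (Y+3) + x(Y²−17), the family) and the COSTUME TEST BY NAME (`¬ DecidedAt 2 M17P` disjunct by disjunct). PORT EDITS: K's module-docstring line «Imports: tree XTop03, LevelFinite13 only» corrected to the four actual imports (writer L2548; docstring-only); 20 one-line docstrings added on undocumented computation lemmas (statements quoted); the 14 `private` helpers of K stay private (file-local copies re-emitted in later parts where used); K's five `set_option maxHeartbeats … in` kept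 as in K; statements and proofs otherwise VERBATIM. Rung 0 — nothing here proves Schanuel, 33364, 33363, 31077, ThinFibre 2 or SiegelShapesOffAt 2; the headline is CONDITIONAL on `PadicSubspace`.)
-/

noncomputable section

namespace Summit.Schanuel.Schanuel.Theorems.RootDecomp1KSubspaceBranch

open Polynomial LiouvilleNumber
open scoped Nat
open Summit.Schanuel.Schanuel.Theorems.RootDecomp1KSkelCell (SkelLiouvilleFix)
open Summit.Schanuel.Schanuel.Theorems.RootDecomp1KTwoBaseCell (psNumer partialSum_eq_psNumer_div)
open Summit.Schanuel.Schanuel.Theorems.RootDecomp1KRelLiouvilleCell (partialSum_two_strictMono)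
open Summit.Schanuel.Schanuel.Theorems.RootDecomp1KDegreeLadder
open Summit.Schanuel.Schanuel.Theorems.RootDecomp1KXLinearCore
open Summit.Schanuel.Schanuel.Theorems.RootDecomp1KXLinear
open Summit.Schanuel.Schanuel.Theorems.RootDecomp1KXLinearII
open Summit.Schanuel.Schanuel.Theorems.RootDecomp1KXTop
open Summit.Schanuel.Schanuel.Theorems.RootDecomp1KXAll
open Summit.Schanuel.Schanuel.Theorems.RootDecomp1KLevelFinite

/-- `‖2‖₂ = 1/2` in `ℂ₂`. -/
private theorem norm_two : ‖(2 : PadicAlgCl 2)‖ = 1 / 2 := by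
  have h1 : ((2 : ℕ) : PadicAlgCl 2) = algebraMap ℚ_[2] (PadicAlgCl 2) ((2 : ℕ) : ℚ_[2]) :=
    (map_natCast _ 2).symm
  have h2 : ‖((2 : ℕ) : ℚ_[2])‖ = (↑(2 : ℕ) : ℝ)⁻¹ := Padic.norm_p
  have h3 : ‖((2 : ℕ) : PadicAlgCl 2)‖ = 1 / 2 := by rw [h1, PadicAlgCl.norm_extends, h2]; norm_num
  simpa using h3

/-- `‖2^t‖₂ = 2^{−t}`. -/
private theorem norm_two_pow (t : ℕ) : ‖(2 : PadicAlgCl 2) ^ t‖ = (1 / 2 : ℝ) ^ t := by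
  rw [norm_pow, norm_two]

/-- `‖z‖₂ ≤ 1` for integers. -/
private theorem norm_intCast_le_one' (z : ℤ) : ‖(z : PadicAlgCl 2)‖ ≤ 1 := by
  have h1 : (z : PadicAlgCl 2) = algebraMap ℚ_[2] (PadicAlgCl 2) (z : ℚ_[2]) := (map_intCast _ z).symm
  rw [h1, PadicAlgCl.norm_extends]
  exact Padic.norm_int_le_one z

/-- `‖n‖₂ ≤ 1` for naturals. -/
private theorem norm_natCast_le_one' (n : ℕ) : ‖(n : PadicAlgCl 2)‖ ≤ 1 := by
  have := norm_intCast_le_one' (n : ℤ)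
  simpa using this

/-- a polynomial separable over `ℚ` is non-zero. -/
private theorem ne_zero_of_map_separable' {B : ℤ[X]} (hsep : (B.map (Int.castRingHom ℚ)).Separable) : B ≠ 0 := by
  rintro rfl
  rw [Polynomial.map_zero] at hsep
  exact not_separable_zero hsep

/-! ### §6  Subspace by subspace: finitely many LEVELS (no Diophantine input) -/

/-- from the relation with `f₀ ≠ 0`, `f₂ = 0` the point is the FIXED rational `−f₁/f₀`. -/
private theorem eq_fixed_of_relation {f : Fin 3 → ℚ} (h0 : f 0 ≠ 0) (h2 : f 2 = 0) {N : ℕ} {r : ℚ}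
    (hrel : f 0 * r.num + f 1 * r.den + f 2 * (2 ^ N ! * r.den) = 0) : r = -f 1 / f 0 := by
  have hden : (r.den : ℚ) ≠ 0 := by exact_mod_cast r.den_nz
  have hnum : (r.num : ℚ) = r * r.den := (Rat.mul_den_eq_num r).symm
  rw [h2, zero_mul, add_zero, hnum] at hrel
  have h : (f 0 * r + f 1) * r.den = 0 := by linear_combination hrel
  have h' : f 0 * r + f 1 = 0 := (mul_eq_zero.mp h).resolve_right hden
  field_simp
  linear_combination h'

set_option maxHeartbeats 400000 in
/-- **FINITELY MANY LEVELS PER RATIONAL SUBSPACE.**  For ANY `P ∈ ℤ[x][Y]`, any window `|r| ≤ C` and any non-zero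
`f ∈ ℚ³`, the levels `N` carrying a non-degenerate point `r` of the window with `f₀·num r + f₁·den r + f₂·2^{N!}·den r = 0`
form a finite set: `f₀ = 0` pins `2^{N!} = −f₁/f₂`; `f₀ ≠ 0 = f₂` pins `r = −f₁/f₀` (tree `levels_finite_of_nondeg`);
`f₀ f₂ ≠ 0` gives `|r| ≥ (|f₂|·2^{N!} − |f₁|)/|f₀| > C` for `N` large.  No Diophantine input. -/
theorem subspace_levels_finite (P : ℤ[X][X]) (C : ℝ) (f : Fin 3 → ℚ) (hf : f ≠ 0) :
    {N : ℕ | ∃ r : ℚ, |(r : ℝ)| ≤ C ∧ bev P (partialSum 2 N) r = 0 ∧ (∃ x : ℝ, bev P x r ≠ 0) ∧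
      f 0 * r.num + f 1 * r.den + f 2 * (2 ^ N ! * r.den) = 0}.Finite := by
  -- the universal bound `N ≤ 2^{N!}`
  have hN2 : ∀ N : ℕ, (N : ℝ) ≤ (2 : ℝ) ^ N ! := fun N =>
    calc (N : ℝ) ≤ (2 : ℝ) ^ N := by exact_mod_cast Nat.lt_two_pow_self.le
      _ ≤ 2 ^ N ! := pow_le_pow_right₀ (by norm_num) (Nat.self_le_factorial N)
  by_cases h0 : f 0 = 0
  · by_cases h2 : f 2 = 0
    · -- `f = (0, f₁, 0)` with `f₁ ≠ 0`: the relation `f₁·den = 0` is impossible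
      have h1 : f 1 ≠ 0 := by
        intro h1; apply hf; funext j
        fin_cases j
        · exact h0
        · exact h1
        · exact h2
      refine Set.finite_empty.subset ?_
      rintro N ⟨r, -, -, -, hrel⟩
      rw [h0, h2, zero_mul, zero_mul, zero_add, add_zero] at hrel
      rcases mul_eq_zero.mp hrel with h | h
      · exact h1 h
      · exact r.den_nz (by exact_mod_cast h)
    · -- `f₀ = 0 ≠ f₂`: `2^{N!} = −f₁/f₂`, so `N ≤ 2^{N!} ≤ |f₁/f₂|`
      obtain ⟨B, hB⟩ := exists_nat_ge (|((f 1 : ℚ) : ℝ) / ((f 2 : ℚ) : ℝ)|)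
      refine (Set.finite_le_nat B).subset ?_
      rintro N ⟨r, -, -, -, hrel⟩
      have hden : (r.den : ℚ) ≠ 0 := by exact_mod_cast r.den_nz
      rw [h0, zero_mul, zero_add] at hrel
      have h12 : (f 1 + f 2 * 2 ^ N !) * r.den = 0 := by linear_combination hrel
      have h12' : f 1 + f 2 * 2 ^ N ! = 0 := (mul_eq_zero.mp h12).resolve_right hden
      have hf2R : ((f 2 : ℚ) : ℝ) ≠ 0 := by exact_mod_cast h2
      have hpow : (2 : ℝ) ^ N ! = -(((f 1 : ℚ) : ℝ) / ((f 2 : ℚ) : ℝ)) := by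
        have h := congrArg (fun q : ℚ => (q : ℝ)) h12'
        push_cast at h
        field_simp
        linarith
      have hle : (N : ℝ) ≤ B := by
        calc (N : ℝ) ≤ (2 : ℝ) ^ N ! := hN2 N
          _ = |(2 : ℝ) ^ N !| := (abs_of_pos (by positivity)).symm
          _ = |((f 1 : ℚ) : ℝ) / ((f 2 : ℚ) : ℝ)| := by rw [hpow, abs_neg]
          _ ≤ B := hB
      exact_mod_cast hle
  · by_cases h2 : f 2 = 0
    · -- `f₀ ≠ 0 = f₂`: the point is the fixed rational `λ = −f₁/f₀`; its levels are finite (tree)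
      by_cases hnd : ∃ x : ℝ, bev P x ((-f 1 / f 0 : ℚ) : ℝ) ≠ 0
      · refine (levels_finite_of_nondeg P (-f 1 / f 0) hnd).subset ?_
        rintro N ⟨r, -, hP, -, hrel⟩
        have hr := eq_fixed_of_relation h0 h2 hrel
        rw [hr] at hP
        exact hP
      · refine Set.finite_empty.subset ?_
        rintro N ⟨r, -, -, hnd', hrel⟩
        have hr := eq_fixed_of_relation h0 h2 hrel
        rw [hr] at hnd'
        exact hnd hnd'
    · -- `f₀ f₂ ≠ 0`: `|f₂|·2^{N!} ≤ C|f₀| + |f₁|`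
      obtain ⟨B, hB⟩ := exists_nat_ge ((C * |((f 0 : ℚ) : ℝ)| + |((f 1 : ℚ) : ℝ)|) / |((f 2 : ℚ) : ℝ)|)
      refine (Set.finite_le_nat B).subset ?_
      rintro N ⟨r, hr, -, -, hrel⟩
      have hden : (r.den : ℚ) ≠ 0 := by exact_mod_cast r.den_nz
      have hnum : (r.num : ℚ) = r * r.den := (Rat.mul_den_eq_num r).symm
      rw [hnum] at hrel
      have h3 : (f 0 * r + f 1 + f 2 * 2 ^ N !) * r.den = 0 := by linear_combination hrel
      have h3' : f 0 * r + f 1 + f 2 * 2 ^ N ! = 0 := (mul_eq_zero.mp h3).resolve_right hden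
      have hf2R : 0 < |((f 2 : ℚ) : ℝ)| := abs_pos.mpr (by exact_mod_cast h2)
      have key : |((f 2 : ℚ) : ℝ)| * (2 : ℝ) ^ N ! ≤ C * |((f 0 : ℚ) : ℝ)| + |((f 1 : ℚ) : ℝ)| := by
        have h := congrArg (fun q : ℚ => (q : ℝ)) h3'
        push_cast at h
        have h1 : ((f 2 : ℚ) : ℝ) * 2 ^ N ! = -(((f 0 : ℚ) : ℝ) * (r : ℝ) + ((f 1 : ℚ) : ℝ)) := by linarith
        calc |((f 2 : ℚ) : ℝ)| * (2 : ℝ) ^ N ! = |((f 2 : ℚ) : ℝ) * 2 ^ N !| := by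
              rw [abs_mul, abs_of_pos (by positivity : (0 : ℝ) < 2 ^ N !)]
          _ = |((f 0 : ℚ) : ℝ) * r + ((f 1 : ℚ) : ℝ)| := by rw [h1, abs_neg]
          _ ≤ |((f 0 : ℚ) : ℝ) * r| + |((f 1 : ℚ) : ℝ)| := abs_add_le _ _
          _ = |((f 0 : ℚ) : ℝ)| * |(r : ℝ)| + |((f 1 : ℚ) : ℝ)| := by rw [abs_mul]
          _ ≤ |((f 0 : ℚ) : ℝ)| * C + |((f 1 : ℚ) : ℝ)| := by gcongr
          _ = C * |((f 0 : ℚ) : ℝ)| + |((f 1 : ℚ) : ℝ)| := by ring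
      have hle : (N : ℝ) ≤ B := by
        calc (N : ℝ) ≤ (2 : ℝ) ^ N ! := hN2 N
          _ ≤ (C * |((f 0 : ℚ) : ℝ)| + |((f 1 : ℚ) : ℝ)|) / |((f 2 : ℚ) : ℝ)| := by
              rw [le_div_iff₀ hf2R, mul_comm]; exact key
          _ ≤ B := hB
      exact_mod_cast hle

/-! ### §7  Assembly: the thin-fibre clause at `m₀ = 2` on the separable-top class, modulo `PadicSubspace` -/

/-- simple roots: `c_k′(β) ≠ 0` at every root `β ∈ ℂ₂` of a `c_k` separable over `ℚ`. -/
theorem aeval_derivative_ne_zero_of_sep (B : ℤ[X]) (hsep : (B.map (Int.castRingHom ℚ)).Separable)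
    {β : PadicAlgCl 2} (hβ : aeval β B = 0) : aeval β (derivative B) ≠ 0 := by
  have hβ' : aeval β (B.map (algebraMap ℤ ℚ)) = 0 := by rwa [aeval_map_algebraMap]
  have h := hsep.aeval_derivative_ne_zero hβ'
  rwa [derivative_map, show Int.castRingHom ℚ = algebraMap ℤ ℚ from rfl, aeval_map_algebraMap] at h

/-- `K₀·2^{−N!} ≤ 1` eventually. -/
private theorem eventually_K₀_small (K₀ : ℝ) (hK₀ : 1 ≤ K₀) :
    ∃ N₅ : ℕ, ∀ N, N₅ ≤ N → K₀ * (1 / 2 : ℝ) ^ N ! ≤ 1 := by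
  have hK₀pos : 0 < K₀ := lt_of_lt_of_le one_pos hK₀
  obtain ⟨n, hn⟩ := exists_pow_lt_of_lt_one (show 0 < 1 / K₀ by positivity) (show (1 / 2 : ℝ) < 1 by norm_num)
  refine ⟨n, fun N hN => ?_⟩
  have h1 : (1 / 2 : ℝ) ^ N ! ≤ (1 / 2 : ℝ) ^ n :=
    pow_le_pow_of_le_one (by norm_num) (by norm_num) (hN.trans (Nat.self_le_factorial N))
  calc K₀ * (1 / 2 : ℝ) ^ N ! ≤ K₀ * (1 / 2 : ℝ) ^ n := by gcongr
    _ ≤ K₀ * (1 / K₀) := mul_le_mul_of_nonneg_left hn.le hK₀pos.le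
    _ = 1 := by field_simp

/-- `2^{N!}·2^{−N!} = 1`. -/
private theorem two_pow_mul_half_pow (n : ℕ) : (2 : ℝ) ^ n * (1 / 2 : ℝ) ^ n = 1 := by
  rw [← mul_pow]; norm_num

set_option maxHeartbeats 1600000 in
/-- **THE SUBSPACE BRANCH — the thin-fibre clause at quality `m₀ = 2`, MODULO `PadicSubspace`.**  For every
`x`-degree `k` (`k = 0` vacuous), top `x`-coefficient `c_k` separable over `ℚ`, and `deg c_j ≤ deg c_k + e` with
`e ≤ 1`: `ThinFibreAt 2 (xPolyP k c)`.  Near a (simple) root `β` of `c_k` the failed clause puts the integer vector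
`(num r, den r, 2^{N!} den r)` into Schlickewei's inequality for the forms of §4 (`ε = 1/8`, §5), hence into one of
finitely many rational subspaces, each of which carries finitely many levels (§6); at `(∞, ∞)` the tree's
`infinity_arith` (`e + 1 ≤ 2`); constant top: `at_infinity_of_const_top`. -/
theorem thinFibreAt_two_of_padicSubspace (hS : PadicSubspace) (k : ℕ) (c : ℕ → ℤ[X]) (e : ℕ)
    (hsep : ((c k).map (Int.castRingHom ℚ)).Separable)
    (hdeg : ∀ j, j < k → (c j).natDegree ≤ (c k).natDegree + e) (he : e ≤ 1) :
    ThinFibreAt 2 (xPolyP k c) := by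
  classical
  have hB : c k ≠ 0 := ne_zero_of_map_separable' hsep
  set lc : PadicAlgCl 2 := ((c k).leadingCoeff : PadicAlgCl 2) with hlc
  have hℓpos : 0 < ‖lc‖ := by
    rw [hlc, norm_pos_iff]; exact_mod_cast leadingCoeff_ne_zero.mpr hB
  intro C
  obtain ⟨N₄, hN₄⟩ := infinity_arith ‖lc‖ C hℓpos e
  -- the `(∞, ∞)` end (tree, no Diophantine input): `‖lc‖·2^{N!} ≤ ‖r‖₂^e ≤ den(r)^e`, `e + 1 ≤ 2`
  have hinf : ∀ N, N₄ ≤ N → ∀ r : ℚ, ‖lc‖ * 2 ^ N ! ≤ ‖(r : PadicAlgCl 2)‖ ^ e →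
      C * 2 ^ (N + 1)! < (r.den : ℝ) ^ (2 * N) := by
    intro N hN r hfar
    have hd1 : (1 : ℝ) ≤ r.den := by exact_mod_cast Nat.succ_le_of_lt r.den_pos
    have hfar' : ‖lc‖ * 2 ^ N ! ≤ (r.den : ℝ) ^ e :=
      hfar.trans (pow_le_pow_left₀ (norm_nonneg _) (norm_ratCast_le_den r) e)
    have h := hN₄ N hN r.den (Nat.succ_le_of_lt r.den_pos) hfar'
    exact h.trans_le (pow_le_pow_right₀ hd1 (Nat.mul_le_mul_right _ (by omega)))
  -- `k = 0`: every point of every level is degenerate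
  rcases Nat.eq_zero_or_pos k with hk0 | hk
  · subst hk0
    refine ⟨0, fun N _ r _ hP hnd => ?_⟩
    obtain ⟨x, hx⟩ := hnd
    exfalso
    apply hx
    rw [bev_xPolyP] at hP ⊢
    simpa using hP
  by_cases hd : 1 ≤ (c k).natDegree
  · obtain ⟨T, cc, N₁, hcc, hTroots, hclose⟩ := near_root_or_at_infinity k c e hd hsep hdeg
    set K₀ : ℝ := max 1 (cc / ‖lc‖) with hK₀
    have hK₀1 : 1 ≤ K₀ := le_max_left _ _
    have hder : ∀ β ∈ T, aeval β (derivative (c k)) ≠ 0 := fun β hβ =>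
      aeval_derivative_ne_zero_of_sep (c k) hsep (hTroots β hβ)
    -- (§3) the refined approximation constant at each root
    have hK : ∀ β ∈ T, ∃ K : ℝ, 0 < K ∧ ∀ N, 3 ≤ N → ∀ r : ℚ, bev (xPolyP k c) (partialSum 2 N) r = 0 →
        ‖(r : PadicAlgCl 2) - β‖ ≤ K₀ * (1 / 2 : ℝ) ^ N ! → ‖(r : PadicAlgCl 2) - β‖ ≤ 1 →
        ‖((r : PadicAlgCl 2) - β) + 2 ^ N ! * (aeval β (c (k - 1)) / aeval β (derivative (c k)))‖ ≤
          K * ((1 / 2 : ℝ) ^ N ! * (1 / 2 : ℝ) ^ (Nat.factorial N - Nat.factorial (N - 1))) :=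
      fun β hβ => refined_approx k hk c e hdeg β (hTroots β hβ) (hder β hβ) K₀ hK₀1
    choose! Kf hKpos hKf using hK
    -- (§0, §4) Schlickewei at each root: finitely many rational subspaces
    have hT : ∀ β ∈ T, ∃ Tβ : Finset (Fin 3 → ℚ), (∀ f ∈ Tβ, f ≠ 0) ∧ ∀ x : Fin 3 → ℤ, x ≠ 0 →
        ((∏ i, |∑ j, Lform i j * (x j : ℝ)|) *
            (∏ i, ‖∑ j, Mform β (aeval β (c (k - 1)) / aeval β (derivative (c k))) i j * (x j : PadicAlgCl 2)‖)) ^ 8 *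
          ((Finset.univ.sup fun j => (x j).natAbs : ℕ) : ℝ) < 1 →
        ∃ f ∈ Tβ, ∑ j, f j * (x j : ℚ) = 0 := by
      intro β hβ
      have halg := isAlgebraic_of_aeval_eq_zero hB (hTroots β hβ)
      have halgγ := isAlgebraic_corr (c (k - 1)) (c k) hB (hTroots β hβ)
      exact hS 3 (by norm_num) 2 Lform (Mform β _) Lform_isAlgebraic (Mform_isAlgebraic halg halgγ)
        Lform_linearIndependent (Mform_linearIndependent _ _) 8 (by norm_num)
    choose! Tf hTf0 hTf using hT
    -- (§6) the bad levels: finitely many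
    have hbad : (⋃ β ∈ (T : Set (PadicAlgCl 2)), ⋃ f ∈ (Tf β : Set (Fin 3 → ℚ)),
        {N : ℕ | ∃ r : ℚ, |(r : ℝ)| ≤ C ∧ bev (xPolyP k c) (partialSum 2 N) r = 0 ∧
          (∃ x : ℝ, bev (xPolyP k c) x r ≠ 0) ∧ f 0 * r.num + f 1 * r.den + f 2 * (2 ^ N ! * r.den) = 0}).Finite := by
      refine T.finite_toSet.biUnion fun β hβ => (Tf β).finite_toSet.biUnion fun f hf => ?_
      exact subspace_levels_finite _ C f (hTf0 β hβ f hf)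
    obtain ⟨N₃, hN₃⟩ := hbad.bddAbove
    -- uniform constants and the exponent inequality (§5)
    set Kmax : ℝ := ∑ β ∈ T, Kf β with hKmax
    have hKle : ∀ β ∈ T, Kf β ≤ Kmax := fun β hβ =>
      Finset.single_le_sum (fun b hb => (hKpos b hb).le) hβ
    have hKmax0 : 0 ≤ Kmax := Finset.sum_nonneg fun b hb => (hKpos b hb).le
    obtain ⟨N₂, hN₂⟩ := subspace_arith (max 1 C * Kmax) (3 * max 1 C) C
    obtain ⟨N₅, hN₅⟩ := eventually_K₀_small K₀ hK₀1
    refine ⟨max (max (max N₁ 3) N₂) (max (N₃ + 1) (max N₄ N₅)), fun N hN r hr hP hnd => ?_⟩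
    simp only [max_le_iff] at hN
    obtain ⟨⟨⟨hNN₁, hN3⟩, hNN₂⟩, hNN₃, hNN₄, hNN₅⟩ := hN
    have hd1 : (1 : ℝ) ≤ r.den := by exact_mod_cast Nat.succ_le_of_lt r.den_pos
    have hC1 : 1 ≤ max 1 C := le_max_left _ _
    rcases hclose N hNN₁ r hP with ⟨β, hβT, hx⟩ | ⟨_, hfar⟩
    · -- near the simple root `β`: the clause holds, or Schlickewei puts the level into the finite bad set
      by_contra hcl
      push Not at hcl
      -- the distance to `β`
      have hδ : ‖(r : PadicAlgCl 2) - β‖ ≤ K₀ * (1 / 2 : ℝ) ^ N ! := by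
        have h1 : ‖(r : PadicAlgCl 2) - β‖ = ‖lc * ((r : PadicAlgCl 2) - β)‖ / ‖lc‖ := by
          rw [norm_mul, mul_div_cancel_left₀ _ hℓpos.ne']
        rw [h1, div_le_iff₀ hℓpos]
        calc ‖lc * ((r : PadicAlgCl 2) - β)‖ ≤ cc * (1 / 2 : ℝ) ^ N ! := hx
          _ = cc / ‖lc‖ * (1 / 2 : ℝ) ^ N ! * ‖lc‖ := by field_simp
          _ ≤ K₀ * (1 / 2 : ℝ) ^ N ! * ‖lc‖ := by gcongr; exact le_max_right _ _
      have hδ1 : ‖(r : PadicAlgCl 2) - β‖ ≤ 1 := hδ.trans (hN₅ N hNN₅)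
      have happrox := hKf β hβT N hN3 r hP hδ hδ1
      set γ : PadicAlgCl 2 := aeval β (c (k - 1)) / aeval β (derivative (c k)) with hγ
      set θ : ℝ := (1 / 2 : ℝ) ^ N ! * (1 / 2 : ℝ) ^ (Nat.factorial N - Nat.factorial (N - 1)) with hθ
      have hθ0 : 0 ≤ θ := by positivity
      -- the Subspace inequality for `x = (num r, den r, 2^{N!} den r)`
      have hreal : |(r.num : ℝ)| * (r.den : ℝ) * (2 ^ N ! * (r.den : ℝ)) ≤
          max 1 C * (r.den : ℝ) ^ 3 * 2 ^ N ! := by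
        have hnumR : |(r.num : ℝ)| = |(r : ℝ)| * r.den := by
          have h := Rat.mul_den_eq_num r
          have h' : ((r * (r.den : ℚ) : ℚ) : ℝ) = ((r.num : ℚ) : ℝ) := by rw [h]
          push_cast at h'
          rw [← h', abs_mul, abs_of_nonneg (by positivity : (0 : ℝ) ≤ (r.den : ℝ))]
        rw [hnumR]
        calc |(r : ℝ)| * r.den * r.den * (2 ^ N ! * r.den) ≤ max 1 C * r.den * r.den * (2 ^ N ! * r.den) := by
              gcongr; exact hr.trans (le_max_right _ _)
          _ = max 1 C * (r.den : ℝ) ^ 3 * 2 ^ N ! := by ring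
      have hpadic : ‖(r.den : PadicAlgCl 2) * (((r : PadicAlgCl 2) - β) + 2 ^ N ! * γ)‖ * ‖(r.den : PadicAlgCl 2)‖ *
          ‖(2 : PadicAlgCl 2) ^ N ! * (r.den : PadicAlgCl 2)‖ ≤ Kmax * θ * (1 / 2 : ℝ) ^ N ! := by
        have hdn : ‖(r.den : PadicAlgCl 2)‖ ≤ 1 := norm_natCast_le_one' _
        have hd3 : ‖(r.den : PadicAlgCl 2)‖ * ‖(r.den : PadicAlgCl 2)‖ * ‖(r.den : PadicAlgCl 2)‖ ≤ 1 :=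
          mul_le_one₀ (mul_le_one₀ hdn (norm_nonneg _) hdn) (norm_nonneg _) hdn
        have hu : ‖((r : PadicAlgCl 2) - β) + 2 ^ N ! * γ‖ * (1 / 2 : ℝ) ^ N ! ≤ Kmax * θ * (1 / 2 : ℝ) ^ N ! := by
          refine mul_le_mul_of_nonneg_right (happrox.trans ?_) (by positivity)
          exact mul_le_mul_of_nonneg_right (hKle β hβT) hθ0
        rw [norm_mul, norm_mul, norm_two_pow]
        calc ‖(r.den : PadicAlgCl 2)‖ * ‖((r : PadicAlgCl 2) - β) + 2 ^ N ! * γ‖ * ‖(r.den : PadicAlgCl 2)‖ *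
              ((1 / 2 : ℝ) ^ N ! * ‖(r.den : PadicAlgCl 2)‖)
            = (‖(r.den : PadicAlgCl 2)‖ * ‖(r.den : PadicAlgCl 2)‖ * ‖(r.den : PadicAlgCl 2)‖) *
                (‖((r : PadicAlgCl 2) - β) + 2 ^ N ! * γ‖ * (1 / 2 : ℝ) ^ N !) := by ring
          _ ≤ 1 * (Kmax * θ * (1 / 2 : ℝ) ^ N !) := mul_le_mul hd3 hu (by positivity) zero_le_one
          _ = Kmax * θ * (1 / 2 : ℝ) ^ N ! := one_mul _
      have hsup := xvec_sup_le N r C hr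
      have harith := hN₂ N hNN₂ r.den (Nat.succ_le_of_lt r.den_pos) hcl
      have hineq : ((∏ i, |∑ j, Lform i j * ((xvec N r j : ℤ) : ℝ)|) *
            (∏ i, ‖∑ j, Mform β γ i j * ((xvec N r j : ℤ) : PadicAlgCl 2)‖)) ^ 8 *
          ((Finset.univ.sup fun j => (xvec N r j).natAbs : ℕ) : ℝ) < 1 := by
        rw [Lform_prod, Mform_prod]
        have hnn1 : 0 ≤ |(r.num : ℝ)| * (r.den : ℝ) * (2 ^ N ! * (r.den : ℝ)) := by positivity
        have hnn2 : 0 ≤ ‖(r.den : PadicAlgCl 2) * (((r : PadicAlgCl 2) - β) + 2 ^ N ! * γ)‖ *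
            ‖(r.den : PadicAlgCl 2)‖ * ‖(2 : PadicAlgCl 2) ^ N ! * (r.den : PadicAlgCl 2)‖ := by positivity
        calc ((|(r.num : ℝ)| * (r.den : ℝ) * (2 ^ N ! * (r.den : ℝ))) *
              (‖(r.den : PadicAlgCl 2) * (((r : PadicAlgCl 2) - β) + 2 ^ N ! * γ)‖ * ‖(r.den : PadicAlgCl 2)‖ *
                ‖(2 : PadicAlgCl 2) ^ N ! * (r.den : PadicAlgCl 2)‖)) ^ 8 *
              ((Finset.univ.sup fun j => (xvec N r j).natAbs : ℕ) : ℝ)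
            ≤ ((max 1 C * (r.den : ℝ) ^ 3 * 2 ^ N !) * (Kmax * θ * (1 / 2 : ℝ) ^ N !)) ^ 8 *
                (3 * max 1 C * 2 ^ N ! * (r.den : ℝ)) := by
              refine mul_le_mul (pow_le_pow_left₀ (mul_nonneg hnn1 hnn2) (mul_le_mul hreal hpadic hnn2 (by positivity)) 8)
                hsup (by positivity) (by positivity)
          _ = (max 1 C * Kmax * (r.den : ℝ) ^ 3 * θ) ^ 8 * (3 * max 1 C * 2 ^ N ! * (r.den : ℝ)) := by
              have h21 := two_pow_mul_half_pow (N !)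
              congr 1
              calc ((max 1 C * (r.den : ℝ) ^ 3 * 2 ^ N !) * (Kmax * θ * (1 / 2 : ℝ) ^ N !)) ^ 8
                  = (max 1 C * Kmax * (r.den : ℝ) ^ 3 * θ * ((2 : ℝ) ^ N ! * (1 / 2 : ℝ) ^ N !)) ^ 8 := by ring
                _ = (max 1 C * Kmax * (r.den : ℝ) ^ 3 * θ) ^ 8 := by rw [h21, mul_one]
          _ < 1 := harith
      obtain ⟨f, hfT, hrel⟩ := hTf β hβT (xvec N r) (xvec_ne_zero N r) hineq
      rw [xvec_relation] at hrel
      have hmem : N ∈ ⋃ β ∈ (T : Set (PadicAlgCl 2)), ⋃ f ∈ (Tf β : Set (Fin 3 → ℚ)),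
          {N : ℕ | ∃ r : ℚ, |(r : ℝ)| ≤ C ∧ bev (xPolyP k c) (partialSum 2 N) r = 0 ∧
            (∃ x : ℝ, bev (xPolyP k c) x r ≠ 0) ∧ f 0 * r.num + f 1 * r.den + f 2 * (2 ^ N ! * r.den) = 0} :=
        Set.mem_biUnion (Finset.mem_coe.mpr hβT) (Set.mem_biUnion (Finset.mem_coe.mpr hfT) ⟨r, hr, hP, hnd, hrel⟩)
      have := hN₃ hmem
      omega
    · exact hinf N hNN₄ r hfar
  · -- constant (non-zero) top coefficient: only the `(∞, ∞)` alternative (tree)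
    have hd0 : (c k).natDegree = 0 := by omega
    obtain ⟨N₁, hN₁⟩ := at_infinity_of_const_top k c e hB hd0 hdeg
    refine ⟨max N₁ N₄, fun N hN r _ hP _ => ?_⟩
    obtain ⟨_, hfar⟩ := hN₁ N (le_trans (le_max_left _ _) hN) r hP
    exact hinf N (le_trans (le_max_right _ _) hN) r hfar

/-- **HEADLINE — node 4's theorem with `3 ≤ m₀` REPLACED by `2 ≤ m₀`, modulo `PadicSubspace`.**  For every
`x`-degree `k`, top `x`-coefficient separable over `ℚ`, `deg c_j ≤ deg c_k + e`, and every `m₀ ≥ 2` with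
`e + 1 ≤ m₀`: `ThinFibreAt m₀ (xPolyP k c)`.  The `m₀ ≥ 3` branch is the tree's `RootDecomp1KXTop.thinFibreAt_xPoly`
BY NAME (`hS` unused there); the new content is `m₀ = 2` (`thinFibreAt_two_of_padicSubspace`). -/
theorem thinFibreAt_xPoly_of_padicSubspace (hS : PadicSubspace) (k : ℕ) (c : ℕ → ℤ[X]) (e : ℕ)
    (hsep : ((c k).map (Int.castRingHom ℚ)).Separable)
    (hdeg : ∀ j, j < k → (c j).natDegree ≤ (c k).natDegree + e) {m₀ : ℕ} (hm : 2 ≤ m₀) (hme : e + 1 ≤ m₀) :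
    ThinFibreAt m₀ (xPolyP k c) := by
  by_cases h3 : 3 ≤ m₀
  · exact thinFibreAt_xPoly k c e hsep hdeg h3 hme
  · have h2 : m₀ = 2 := by omega
    subst h2
    exact thinFibreAt_two_of_padicSubspace hS k c e hsep hdeg (by omega)

end Summit.Schanuel.Schanuel.Theorems.RootDecomp1KSubspaceBranch

end
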